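import Summits.QuantumFields.YangMills.Theorems.UnitScaleTiltProp7PinnedBiharmonicAgmonLetters
import HarnessLib

/-!
# Route `UnitScaleTilt`, crux K1 «MinimiserStabilityRegPr» (stmt-QuantumFields-19200), route-R E′ path (α′), sup row (hK) — (D2′) AGMON, FILE 2∕3:
# THE WEIGHTED INTERPOLATION INEQUALITY `Σ_b(ω(b₋)∂e(b))² ≤ 2‖ωe‖‖ωΔe‖ + γ²‖ωe‖²` (`γ = (15∕4)a|c|√d`), the rows of `ω²` read through `ω⁻¹`,
# and the square-root bookkeeping (Cauchy–Schwarz from below)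

Cell `ym3-torus`, D-0154 (3c) width seat `ym-routeR-w6` (gen 5), on ★routeR-w3 g5's «routeR-w6: GO (D2′)» 2026-08-28T18:22:37Z (interface (1)–(4) of
that line); `--supports stmt-QuantumFields-19200`, count-neutral.  THEOREMS ONLY (0 `def`, 0 `sorry`).  YM₃ on T³ is a ladder rung (R3), not the
Clay problem; nothing here claims the stub, the crux, d = 4 or the gap.

THE POINT.  In Agmon's argument the commutator `[Δ, ω]e` is first order in `e` (file 1), so one needs the weighted gradient `‖ω∂e‖` in terms of
`‖ωe‖` and `‖ωΔe‖`: Green's identity for `ω²e` against `e` plus the Leibniz rule for `∂(ω²e)` give `Σ_bω(b₋)²(∂e)² = Σ_xω²eΔe −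
Σ_b c(ω(b₊)² − ω(b₋)²)e(b₊)∂e(b)`, and the boundary-of-Leibniz term is `O(a)` (first differences of `ω`), absorbed by Cauchy–Schwarz
(`weighted_grad_sq_le`).  The rows of the squared weight (`sq_weight_rows`: `ω⁻¹|δ^±ω²| ≤ (5∕2)aω`, `ω⁻¹|δ²ω²| ≤ (2a² + 2b)ω`) are what file 3
feeds to file 1's commutator bound when the Euler–Lagrange identity is tested with `v = ω²e`.

WHAT IS PROVED (ns `…Theorems.Prop7PinnedBiharmonicAgmonInterp`; real site fields, `LatticeFieldCalculus` letters, lattice factor `c`).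
* §3 `sqrt_sum_univ_add_sq_le` (`√Σ(f+g)² ≤ √Σf² + √Σg²` over a `Fintype`), `neg_sqrt_mul_sqrt_le_sum_mul` (`−√Σf²√Σg² ≤ Σfg`).
* §4 ★★ `weighted_grad_sq_le` — `Σ_b(ω(b₋)∂e(b))² ≤ 2√Σ(ωe)²·√Σ(ωΔe)² + ((15∕4)a|c|√d)²·Σ(ωe)²` for `a ≤ 1∕2`.
* §5 `sq_weight_rows`, `sqrt_comm_bound_le` (`√(10dα²c²X + 3d²β²c⁴Y) ≤ √(10d)α|c|√X + √3·dβc²√Y`).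
HONEST SCOPE.  Elementary; no analytic input beyond file 1.  The Agmon estimate itself is file 3 (`…PinnedBiharmonicAgmonDecay`).

References: T. Bałaban, CMP 95 (1984) 17–40 [Balaban1984PropagatorsI] ((1.21) p.21); CMP 96 (1984) 223–250 [Balaban1984PropagatorsII] ((1.9) p.226).
-/

set_option autoImplicit false

noncomputable section

open scoped BigOperators

namespace Summit.QuantumFields.YangMills.Theorems.Prop7PinnedBiharmonicAgmonInterp

open Literature.MathematicalPhysics.QuantumFieldTheory.Balaban1983to89
open Finset LatticeFieldCalculus
open B10StarCount (sum_pbond shift_unshift unshift_shift)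
open Summit.QuantumFields.YangMills.Theorems.Prop7CentreHarmonicInterpKernel (sum_comp_shift sum_comp_unshift' laplace_sub')
open Summit.QuantumFields.YangMills.Theorems.Prop7PinnedHodgeSplit (sum_mul_laplace_eq_sum_grad_mul sum_mul_laplace_comm)
open Summit.QuantumFields.YangMills.Theorems.Prop7PinnedBiharmonicAgmonLetters

variable {P : Params} {j : ℕ}

/-! ## §3 Real-analysis helpers: `ℓ²` triangle and square-root bookkeeping -/

/-- the `ℓ²` TRIANGLE INEQUALITY over a finite type: `√Σ(f+g)² ≤ √Σf² + √Σg²` (Cauchy–Schwarz). [folklore] -/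
theorem sqrt_sum_univ_add_sq_le {ι : Type*} [Fintype ι] (f g : ι → ℝ) :
    Real.sqrt (∑ i, (f i + g i) ^ 2) ≤ Real.sqrt (∑ i, f i ^ 2) + Real.sqrt (∑ i, g i ^ 2) := by
  rw [Real.sqrt_le_left (by positivity)]
  have hcs := Real.sum_mul_le_sqrt_mul_sqrt Finset.univ f g
  have hF := Real.sq_sqrt (Finset.sum_nonneg fun i (_ : i ∈ (Finset.univ : Finset ι)) => sq_nonneg (f i))
  have hG := Real.sq_sqrt (Finset.sum_nonneg fun i (_ : i ∈ (Finset.univ : Finset ι)) => sq_nonneg (g i))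
  have e : ∑ i, (f i + g i) ^ 2 = ∑ i, f i ^ 2 + 2 * ∑ i, f i * g i + ∑ i, g i ^ 2 := by
    rw [Finset.mul_sum, ← Finset.sum_add_distrib, ← Finset.sum_add_distrib]
    exact Finset.sum_congr rfl fun i _ => by ring
  rw [e]
  nlinarith [Real.sqrt_nonneg (∑ i, f i ^ 2), Real.sqrt_nonneg (∑ i, g i ^ 2)]

/-- CAUCHY–SCHWARZ from below: `−√Σf²·√Σg² ≤ Σ f g`. [folklore] -/
theorem neg_sqrt_mul_sqrt_le_sum_mul {ι : Type*} (s : Finset ι) (f g : ι → ℝ) :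
    -(Real.sqrt (∑ i ∈ s, f i ^ 2) * Real.sqrt (∑ i ∈ s, g i ^ 2)) ≤ ∑ i ∈ s, f i * g i := by
  have h := Real.sum_mul_le_sqrt_mul_sqrt s (fun i => -f i) g
  have e1 : ∑ i ∈ s, (fun i => -f i) i ^ 2 = ∑ i ∈ s, f i ^ 2 := Finset.sum_congr rfl fun i _ => by ring
  have e2 : ∑ i ∈ s, (fun i => -f i) i * g i = -∑ i ∈ s, f i * g i := by
    rw [← Finset.sum_neg_distrib]; exact Finset.sum_congr rfl fun i _ => by ring
  rw [e1, e2] at h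
  linarith

/-! ## §4 The weighted interpolation inequality (`∂` between `e` and `Δe`) -/

/-- **WEIGHTED INTERPOLATION**: for a weight with first-difference constant `a ≤ 1/2`,
`Σ_b (ω(b₋)∂e(b))² ≤ 2·√Σ(ωe)²·√Σ(ωΔe)² + γ²·Σ(ωe)²`, `γ = (15/4)·a|c|√d` (Green's identity for `ω²e` against `e`, the Leibniz
rule for `∂(ω²e)`, Cauchy–Schwarz). [folklore] -/
theorem weighted_grad_sq_le (c : ℝ) (ω e : SiteField P j ℝ) {a : ℝ} (ha0 : 0 ≤ a) (ha : a ≤ 1 / 2) (hω₀ : ∀ x, 0 < ω x)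
    (hω₁ : ∀ x μ, |ω (x.shift μ) - ω x| ≤ a * ω x ∧ |ω (x.unshift μ) - ω x| ≤ a * ω x) :
    ∑ b : PBond P j, (ω b.src * grad c e b) ^ 2
      ≤ 2 * Real.sqrt (∑ x : Site P j, (ω x * e x) ^ 2) * Real.sqrt (∑ x : Site P j, (ω x * laplace c e x) ^ 2)
        + (15 / 4 * a * |c| * Real.sqrt P.d) ^ 2 * ∑ x : Site P j, (ω x * e x) ^ 2 := by
  -- Green: `Σ_x (ω²e)Δe = Σ_b ∂(ω²e)∂e = Σ_b ω₋²(∂e)² + Σ_b c(ω₊²−ω₋²)e₊∂e`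
  have hgreen := sum_mul_laplace_eq_sum_grad_mul c (fun y => ω y ^ 2 * e y) e
  have hsplit : ∑ b : PBond P j, grad c (fun y => ω y ^ 2 * e y) b * grad c e b
      = ∑ b : PBond P j, (ω b.src * grad c e b) ^ 2
        + ∑ b : PBond P j, c * (ω b.tgt ^ 2 - ω b.src ^ 2) * e b.tgt * grad c e b := by
    rw [← Finset.sum_add_distrib]
    refine Finset.sum_congr rfl fun b _ => ?_
    rw [grad_mul' c (fun y => ω y ^ 2) e b]; ring
  set N := Real.sqrt (∑ x : Site P j, (ω x * e x) ^ 2) with hN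
  set E := Real.sqrt (∑ x : Site P j, (ω x * laplace c e x) ^ 2) with hE
  set G2 := ∑ b : PBond P j, (ω b.src * grad c e b) ^ 2 with hG2
  have hN0 : 0 ≤ N := Real.sqrt_nonneg _
  have hG20 : 0 ≤ G2 := Finset.sum_nonneg fun _ _ => sq_nonneg _
  -- (1) `Σ_x ω²eΔe ≤ N·E`
  have h1 : ∑ x : Site P j, (ω x ^ 2 * e x) * laplace c e x ≤ N * E := by
    have h := Real.sum_mul_le_sqrt_mul_sqrt Finset.univ (fun x => ω x * e x) (fun x => ω x * laplace c e x)
    have e : ∑ x : Site P j, (ω x ^ 2 * e x) * laplace c e x = ∑ x : Site P j, (ω x * e x) * (ω x * laplace c e x) :=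
      Finset.sum_congr rfl fun x _ => by ring
    rw [e]; exact h
  -- (2) the boundary-of-Leibniz term: `|c(ω₊²−ω₋²)e₊∂e| ≤ (15/4)a|c|·(ω₊|e₊|)(ω₋|∂e|)`
  have h2 : ∀ b : PBond P j, -(c * (ω b.tgt ^ 2 - ω b.src ^ 2) * e b.tgt * grad c e b)
      ≤ (15 / 4 * a * |c|) * ((ω b.tgt * |e b.tgt|) * (ω b.src * |grad c e b|)) := by
    intro b
    have hs : 0 < ω b.src := hω₀ _
    have ht : 0 < ω b.tgt := hω₀ _
    have hts : ω b.tgt ≤ 3 / 2 * ω b.src := weight_shift_le ω ha hω₀ hω₁ b.src b.dir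
    have hst : ω b.src ≤ 3 / 2 * ω b.tgt := by
      have := weight_unshift_le ω ha hω₀ hω₁ b.tgt b.dir
      rwa [show b.tgt.unshift b.dir = b.src from unshift_shift b.src b.dir] at this
    have hd1 : |ω b.tgt - ω b.src| ≤ a * ω b.src := (hω₁ b.src b.dir).1
    have hdiff : |ω b.tgt ^ 2 - ω b.src ^ 2| ≤ 5 / 2 * a * ω b.src ^ 2 := by
      rw [show ω b.tgt ^ 2 - ω b.src ^ 2 = (ω b.tgt - ω b.src) * (ω b.tgt + ω b.src) by ring, abs_mul,
        abs_of_pos (show (0 : ℝ) < ω b.tgt + ω b.src by linarith)]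
      calc |ω b.tgt - ω b.src| * (ω b.tgt + ω b.src) ≤ (a * ω b.src) * (3 / 2 * ω b.src + ω b.src) :=
            mul_le_mul hd1 (by linarith) (by linarith) (by positivity)
        _ = 5 / 2 * a * ω b.src ^ 2 := by ring
    have key : |c * (ω b.tgt ^ 2 - ω b.src ^ 2) * e b.tgt * grad c e b|
        ≤ (15 / 4 * a * |c|) * ((ω b.tgt * |e b.tgt|) * (ω b.src * |grad c e b|)) := by
      rw [abs_mul, abs_mul, abs_mul]
      calc |c| * |ω b.tgt ^ 2 - ω b.src ^ 2| * |e b.tgt| * |grad c e b|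
          ≤ |c| * (5 / 2 * a * ω b.src ^ 2) * |e b.tgt| * |grad c e b| := by gcongr
        _ = 5 / 2 * a * |c| * (ω b.src * |e b.tgt|) * (ω b.src * |grad c e b|) := by ring
        _ ≤ 5 / 2 * a * |c| * (3 / 2 * ω b.tgt * |e b.tgt|) * (ω b.src * |grad c e b|) := by
            gcongr
        _ = (15 / 4 * a * |c|) * ((ω b.tgt * |e b.tgt|) * (ω b.src * |grad c e b|)) := by ring
    exact (neg_le_abs _).trans key
  -- (3) Cauchy–Schwarz on the boundary term: `Σ_b (ω₊|e₊|)(ω₋|∂e|) ≤ √(d·N²)·√G2`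
  have h3 : ∑ b : PBond P j, (ω b.tgt * |e b.tgt|) * (ω b.src * |grad c e b|) ≤ Real.sqrt P.d * N * Real.sqrt G2 := by
    have h := Real.sum_mul_le_sqrt_mul_sqrt Finset.univ (fun b : PBond P j => ω b.tgt * |e b.tgt|)
      (fun b => ω b.src * |grad c e b|)
    have e1 : ∑ b : PBond P j, (ω b.tgt * |e b.tgt|) ^ 2 = P.d * ∑ x : Site P j, (ω x * e x) ^ 2 := by
      rw [← sum_bond_tgt (fun y => (ω y * e y) ^ 2)]
      exact Finset.sum_congr rfl fun b _ => by rw [mul_pow, mul_pow, sq_abs]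
    have e2 : ∑ b : PBond P j, (ω b.src * |grad c e b|) ^ 2 = G2 := Finset.sum_congr rfl fun b _ => by
      rw [mul_pow, mul_pow, sq_abs]
    rw [e1, e2, Real.sqrt_mul (Nat.cast_nonneg _)] at h
    simpa only [mul_assoc] using h
  -- assemble: `G2 ≤ N E + γ N √G2`, then absorb
  have h4 : G2 ≤ N * E + (15 / 4 * a * |c| * Real.sqrt P.d) * N * Real.sqrt G2 := by
    have hb : -(∑ b : PBond P j, c * (ω b.tgt ^ 2 - ω b.src ^ 2) * e b.tgt * grad c e b)
        ≤ (15 / 4 * a * |c|) * (Real.sqrt P.d * N * Real.sqrt G2) := by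
      rw [← Finset.sum_neg_distrib]
      refine (Finset.sum_le_sum fun b _ => h2 b).trans ?_
      rw [← Finset.mul_sum]
      exact mul_le_mul_of_nonneg_left h3 (by positivity)
    have := hgreen
    rw [hsplit] at this
    nlinarith
  have hsq : Real.sqrt G2 ^ 2 = G2 := Real.sq_sqrt hG20
  have hNsq : N ^ 2 = ∑ x : Site P j, (ω x * e x) ^ 2 := Real.sq_sqrt (Finset.sum_nonneg fun _ _ => sq_nonneg _)
  rw [← hNsq]
  nlinarith [sq_nonneg (Real.sqrt G2 - (15 / 4 * a * |c| * Real.sqrt P.d) * N)]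

/-! ## §5 Rows of the squared weight `ω²` and of the inverse weight -/

/-- first/second-difference rows of `ω²` read through `θ = ω⁻¹`: `ω⁻¹|ω(x±e_μ)² − ω(x)²| ≤ (5/2)a·ω(x)` and
`ω⁻¹|ω(x+e_μ)² + ω(x−e_μ)² − 2ω(x)²| ≤ (2a² + 2b)·ω(x)` (`a ≤ 1/2`). [folklore] -/
theorem sq_weight_rows (ω : SiteField P j ℝ) {a b : ℝ} (ha0 : 0 ≤ a) (ha : a ≤ 1 / 2) (hω₀ : ∀ x, 0 < ω x)
    (hω₁ : ∀ x μ, |ω (x.shift μ) - ω x| ≤ a * ω x ∧ |ω (x.unshift μ) - ω x| ≤ a * ω x)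
    (hω₂ : ∀ x μ, |ω (x.shift μ) + ω (x.unshift μ) - 2 * ω x| ≤ b * ω x) (x : Site P j) (μ : Fin P.d) :
    ((ω x)⁻¹ * |ω (x.shift μ) ^ 2 - ω x ^ 2| ≤ 5 / 2 * a * ω x ∧ (ω x)⁻¹ * |ω (x.unshift μ) ^ 2 - ω x ^ 2| ≤ 5 / 2 * a * ω x)
      ∧ (ω x)⁻¹ * |ω (x.shift μ) ^ 2 + ω (x.unshift μ) ^ 2 - 2 * ω x ^ 2| ≤ (2 * a ^ 2 + 2 * b) * ω x := by
  have hx := hω₀ x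
  have hxi : 0 < (ω x)⁻¹ := inv_pos.mpr hx
  have h1 := (hω₁ x μ).1
  have h2 := (hω₁ x μ).2
  have h3 := hω₂ x μ
  have hp := weight_shift_le ω ha hω₀ hω₁ x μ
  have hm := weight_unshift_le ω ha hω₀ hω₁ x μ
  have hp0 := hω₀ (x.shift μ)
  have hm0 := hω₀ (x.unshift μ)
  -- generic first-difference estimate
  have first : ∀ y : ℝ, 0 < y → y ≤ 3 / 2 * ω x → |y - ω x| ≤ a * ω x → (ω x)⁻¹ * |y ^ 2 - ω x ^ 2| ≤ 5 / 2 * a * ω x := by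
    intro y hy hy' hd
    rw [show y ^ 2 - ω x ^ 2 = (y - ω x) * (y + ω x) by ring, abs_mul, abs_of_pos (show (0:ℝ) < y + ω x by linarith)]
    calc (ω x)⁻¹ * (|y - ω x| * (y + ω x)) ≤ (ω x)⁻¹ * ((a * ω x) * (5 / 2 * ω x)) :=
          mul_le_mul_of_nonneg_left (mul_le_mul hd (by linarith) (by linarith) (by positivity)) hxi.le
      _ = 5 / 2 * a * ω x * ((ω x)⁻¹ * ω x) := by ring
      _ = 5 / 2 * a * ω x := by rw [inv_mul_cancel₀ hx.ne', mul_one]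
  refine ⟨⟨first _ hp0 hp h1, first _ hm0 hm h2⟩, ?_⟩
  have e : ω (x.shift μ) ^ 2 + ω (x.unshift μ) ^ 2 - 2 * ω x ^ 2
      = (ω (x.shift μ) - ω x) ^ 2 + (ω (x.unshift μ) - ω x) ^ 2 + 2 * ω x * (ω (x.shift μ) + ω (x.unshift μ) - 2 * ω x) := by
    ring
  rw [e]
  have hb1 : (ω (x.shift μ) - ω x) ^ 2 ≤ (a * ω x) ^ 2 := by
    rw [← sq_abs]; exact pow_le_pow_left₀ (abs_nonneg _) h1 2
  have hb2 : (ω (x.unshift μ) - ω x) ^ 2 ≤ (a * ω x) ^ 2 := by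
    rw [← sq_abs]; exact pow_le_pow_left₀ (abs_nonneg _) h2 2
  have hb3 : |2 * ω x * (ω (x.shift μ) + ω (x.unshift μ) - 2 * ω x)| ≤ 2 * ω x * (b * ω x) := by
    rw [abs_mul, abs_of_pos (by linarith)]
    exact mul_le_mul_of_nonneg_left h3 (by linarith)
  calc (ω x)⁻¹ * |(ω (x.shift μ) - ω x) ^ 2 + (ω (x.unshift μ) - ω x) ^ 2
        + 2 * ω x * (ω (x.shift μ) + ω (x.unshift μ) - 2 * ω x)|
      ≤ (ω x)⁻¹ * ((a * ω x) ^ 2 + (a * ω x) ^ 2 + 2 * ω x * (b * ω x)) := by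
        apply mul_le_mul_of_nonneg_left _ hxi.le
        refine (abs_add_three _ _ _).trans ?_
        rw [abs_of_nonneg (sq_nonneg _), abs_of_nonneg (sq_nonneg _)]
        linarith
    _ = (2 * a ^ 2 + 2 * b) * ω x * ((ω x)⁻¹ * ω x) := by ring
    _ = (2 * a ^ 2 + 2 * b) * ω x := by rw [inv_mul_cancel₀ hx.ne', mul_one]

/-- `√(10d·(α²c²)·X + 3d²·(β²c⁴)·Y) ≤ √(10d)·α|c|·√X + √3·d·β·c²·√Y` for `α, β, X, Y ≥ 0`. [folklore] -/
theorem sqrt_comm_bound_le {d : ℕ} {α β c X Y : ℝ} (hα : 0 ≤ α) (hβ : 0 ≤ β) (hX : 0 ≤ X) (hY : 0 ≤ Y) :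
    Real.sqrt (10 * d * (α ^ 2 * c ^ 2) * X + 3 * (d : ℝ) ^ 2 * (β ^ 2 * c ^ 4) * Y)
      ≤ Real.sqrt (10 * d) * α * |c| * Real.sqrt X + Real.sqrt 3 * d * β * c ^ 2 * Real.sqrt Y := by
  have hd : (0 : ℝ) ≤ d := Nat.cast_nonneg _
  have e1 : 10 * d * (α ^ 2 * c ^ 2) * X = (Real.sqrt (10 * d) * α * |c| * Real.sqrt X) ^ 2 := by
    rw [mul_pow, mul_pow, mul_pow, Real.sq_sqrt (by positivity), sq_abs, Real.sq_sqrt hX]; ring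
  have e2 : 3 * (d : ℝ) ^ 2 * (β ^ 2 * c ^ 4) * Y = (Real.sqrt 3 * d * β * c ^ 2 * Real.sqrt Y) ^ 2 := by
    rw [mul_pow, mul_pow, mul_pow, mul_pow, Real.sq_sqrt (by norm_num), Real.sq_sqrt hY]; ring
  rw [e1, e2]
  have hadd : ∀ x y : ℝ, 0 ≤ x → 0 ≤ y → Real.sqrt (x + y) ≤ Real.sqrt x + Real.sqrt y := fun x y hx hy => by
    rw [Real.sqrt_le_left (by positivity)]
    have h1 := Real.sq_sqrt hx
    have h2 := Real.sq_sqrt hy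
    nlinarith [Real.sqrt_nonneg x, Real.sqrt_nonneg y]
  refine (hadd _ _ (sq_nonneg _) (sq_nonneg _)).trans ?_
  rw [Real.sqrt_sq (by positivity), Real.sqrt_sq (by positivity)]

end Summit.QuantumFields.YangMills.Theorems.Prop7PinnedBiharmonicAgmonInterp

end
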